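import Summits.QuantumFields.YangMills.Theorems.FluctuationComparisonRegPrIntLS2BetaAbelianCriticalOfMin
import Summits.QuantumFields.YangMills.Theorems.FluctuationComparisonRegPrIntLS2BetaCriticalELRelated
import Summits.QuantumFields.YangMills.Theorems.AlphaInputsT3ACMinimiserPin
import HarnessLib

/-!
# S2β · [Balaban1985Variational] PROP. 7 CLAUSE 1 AT THE ABELIAN STRATUM, `L ≥ 5`: AT MOST ONE CRITICAL (4)-ORBIT OVER A DATUM WITH DIAGONAL-CONSTANT STABILISER,
# MODULO ONE ABELIAN LETTER EX^{ab} («a σ₃-diagonal constrained minimiser of the regular fibre exists»)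

Cell `ym3-torus` (YM ladder rung R3 = continuum `SU(2)` Yang–Mills on the three-torus at fixed lattice data — a RUNG: NOT d = 4, NOT infinite volume,
NOT a mass gap, NOT Clay).  Width seat `ym3-torus-px12` (gen 21), pen (B) «ABELIAN STRATUM» FILE 3; crux `stmt-QuantumFields-20520`
(`…Theses.UnitScaleTilt.FluctuationComparisonRegPrIntL`), LINE S2β; `--kind proof --supports stmt-QuantumFields-20520 --as helper`: count-neutral, DEFINITION-FREE
(0 `def`, 0 `instance`, 0 `notation`, 0 `sorry`, default heartbeats).

WHY.  ✓px17 pen 7 `atMostOneCriticalOrbit_of_el_symmetriesLift_five` (✓p800335) proves print's (4)-orbit uniqueness over `V` as soon as SOME regular fibre point `W` is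
E–L-critical along every fibre curve AND the datum's symmetries lift to symmetries of `W`.  ✓FILE 2 `el_of_abelianMin` supplies the first for an abelian constrained
minimiser `W = e^{a·iσ₃}`; at a datum whose stabiliser consists of constant σ₃-diagonal gauge transformations (the genuinely abelian datum, case A of
✓`parallelConstDiag_or_loopHol_central` after the coarse gauge of ✓`onlyScalar_or_exists_gauge_commute_sigma3`) a σ₃-DIAGONAL `W` has the lift property trivially (the same
constant) — §1.  Transporting the lift property along ✓pen 7 `critical_gaugeRelated_of_el_five` ∕ `symmetriesLift_gaugeAct` gives it at EVERY R2-critical point over `V`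
(the `hlift` token of ✓px8 g19's (T7-red) at the organ's own base point `U₀`).

WHAT.
* §1 `descTransf_const`; `symmetriesLift_of_diagonal` — pen 4's `hlift` at a σ₃-diagonal configuration over a datum with diagonal-constant stabiliser;
  `stab_const_of_parallelConstDiag` — case A ⇒ diagonal-constant stabiliser.
* §2 ★★★`atMostOneCriticalOrbit_of_abelianMin_five (L) (h5 : 5 ≤ L)` — `∃ e₉ > 0`, for every member `F` (`F.L = L`), heights `n < K` (`K − n ≤ m + K_P`), every
  `0 < e ≤ e₉` admissible ((12)–(13)-type rows), every datum `V` whose stabiliser is diagonal-constant, and every lettering `a` with strict loop-sum guards such that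
  `e^{a·iσ₃} ∈ regFibrePr F n K e V` minimises the Wilson action among the σ₃-diagonal members of `regFibrePr F n K e V` (EX^{ab}, DISPLAYED):
  `(varProblem3 F n K hnK.le).AtMostOneCriticalOrbit e V` — Prop. 7 clause 1 in the tree's schema letters, at that datum; ★★★`symmetriesLift_at_critical_of_abelianMin_five`
  — under the same hypotheses, pen 4's `hlift` holds at EVERY R2-critical `U₀ ∈ regFibrePr F n K e V`; `…_caseA_five` editions with case A in place of `hStab`.

HONEST.  EX^{ab} is an existence statement about the ABELIAN (U(1), linear-constraint) problem and is NOT proved here; the datum's stabiliser shape is a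
hypothesis (kinematic; the coarse re-gauging to it is px16 g18's orbit transport + the 19200 SYM-CENTRE stratification, cited not restated); nothing of Bałaban's
analysis is asserted beyond the cited tree theorems; Prop. 7 cl. 1 as the window schema `Prop7AtMostOneCriticalOrbitAt`, (E), ISOL∘, TUBE-REG∘, GAP♯∘, EXW∘, S2β and
crux 20520 are NOT proved; at `L = 3` the Thm-2 socket is open (EMBARGO-LITE №58); rung R3 = `YM3TorusSU2` as filed — SU(2) YM₃ on T³; the Yang–Mills mass gap is
NOT proved.  Sorry-free, axioms standard.
[cite: Balaban1985Variational, (2)-(6) p.278, Prop. 7 p.299, (141)-(143) p.299, (111) p.294; Balaban1985RegularSpaces, Thm 2 p.83; Balaban1985Averaging, (52)-(54) p.26; Balaban1987RG1, (0.4)+(0.11) p.253]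
-/

set_option autoImplicit false

noncomputable section

open scoped Matrix.Norms.L2Operator Topology
open Filter Function
open Literature.MathematicalPhysics.QuantumFieldTheory.Balaban1983to89
open Literature.MathematicalPhysics.QuantumFieldTheory.Balaban1983to89.T4Continuum
open Literature.MathematicalPhysics.QuantumFieldTheory.Balaban1983to89.BlockAveraging (blockAvg Idx)
open Literature.MathematicalPhysics.QuantumFieldTheory.Balaban1983to89.ExpMeanLog (expMeanLogSU deltaSU deltaSU_pos)
open Literature.MathematicalPhysics.QuantumFieldTheory.Balaban1983to89.B9AdOrthogonal (σ₃)
open Literature.MathematicalPhysics.QuantumFieldTheory.Balaban1983to89.B10Eq27TorusAxialLog (unitsField toUField)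
open Literature.MathematicalPhysics.QuantumFieldTheory.Balaban1983to89.B5Positivity172Lattice (TT ofT)
open Literature.MathematicalPhysics.QuantumFieldTheory.Balaban1983to89.T3ContinuumYM3Torus
open Literature.MathematicalPhysics.QuantumFieldTheory.Balaban1983to89.T3UnitLawDensityEML (ℰp)
open Literature.MathematicalPhysics.QuantumFieldTheory.Balaban1983to89.T3TiltDescent (descendTo)
open Literature.MathematicalPhysics.QuantumFieldTheory.Balaban1983to89.T3ConstrainedMinimiser (fibre)
open Literature.MathematicalPhysics.QuantumFieldTheory.Balaban1983to89.T3PrintedRegularMinimiser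
open Literature.MathematicalPhysics.QuantumFieldTheory.Balaban1983to89.T3RegularMinimiser (regThreshold)
open Literature.MathematicalPhysics.QuantumFieldTheory.Balaban1983to89.T3PrintedRegularOrbits (descTransf)
open Literature.MathematicalPhysics.QuantumFieldTheory.Balaban1983to89.T3Thm1Carrier (SameOrbit varProblem3)
open Literature.MathematicalPhysics.QuantumFieldTheory.Balaban1983to89.T3Thm1CarrierNative (IsCritR2)
open Literature.MathematicalPhysics.QuantumFieldTheory.Balaban1983to89.T3SectALandauChart (sameOrbit_symm sameOrbit_trans)
open Summit.QuantumFields.Balaban3D.Carriers (suGroupModel)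
open Summit.QuantumFields.YangMills.Theorems.BlockAvgCorrector (stokesConst)
open Summit.QuantumFields.YangMills.Theorems.AbelianEML (gexpAt linAvgIter loopSum)
open Summit.QuantumFields.YangMills.Theorems.Prop7SymCentreAbelianDict (I_smul_sigma3_mem_lie)
open Summit.QuantumFields.YangMills.Theorems.Prop7SymCentreAbelianFibre (commute_coe_gexpAt_sigma3)
open Summit.QuantumFields.YangMills.Theorems.Prop7NestedMeanParallelLiftDiagGauge (commute_of_commute_sigma3 coe_unitsField_toUField coe_inv_unitsField_toUField)
open Summit.QuantumFields.YangMills.Theorems.MinimiserPin (plaqSmall_two_iter_blockAvg)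
open Summit.QuantumFields.YangMills.Theorems.FluctuationComparisonRegPrIntLS2BetaCriticalELRelated
  (symmetriesLift_gaugeAct critical_gaugeRelated_of_el_five atMostOneCriticalOrbit_of_el_symmetriesLift_five)
open Summit.QuantumFields.YangMills.Theorems.Prop7CritEL (deriv_comp_eq_zero_of_isCritR2 continuousAt_of_differentiableAt_bonds)
open Summit.QuantumFields.YangMills.Theorems.FluctuationComparisonRegPrIntLS2BetaAbelianSymmetricCriticality (transfUp_const)
open Summit.QuantumFields.YangMills.Theorems.FluctuationComparisonRegPrIntLS2BetaAbelianCriticalOfMin (el_of_abelianMin)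

namespace Summit.QuantumFields.YangMills.Theorems.FluctuationComparisonRegPrIntLS2BetaCriticalOrbitUniqueAbelian

/-! ## §1 E–L-critical ⇒ R2-critical; the lift property of a diagonal configuration -/

section Pieces

variable (F : T3Family) {n K : ℕ}

/-- The descended transformation of a CONSTANT gauge transformation is the same constant. [cite: Balaban1985Averaging, (11) p.19 (bookkeeping)] -/
theorem descTransf_const (h : n ≤ K) (c : Matrix.specialUnitaryGroup (Fin 2) ℂ) :
    descTransf F n K h (fun _ => c) = fun _ => c := by
  funext x
  unfold descTransf
  rw [transfUp_const]

/-- **THE LIFT PROPERTY OF A σ₃-DIAGONAL CONFIGURATION AT A DATUM WITH DIAGONAL-CONSTANT STABILISER**: every `s` with `s • V = V` is a constant σ₃-diagonal `c`, and the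
same constant fixes the diagonal `W` and descends to `s` — pen 4's `hlift`. [cite: Balaban1985Variational, (4) p.278; Balaban1985Averaging, (11) p.19] -/
theorem symmetriesLift_of_diagonal (h : n ≤ K) {V : GaugeField (F.P n) 0 (Matrix.specialUnitaryGroup (Fin 2) ℂ)}
    {W : GaugeField (F.P K) 0 (Matrix.specialUnitaryGroup (Fin 2) ℂ)}
    (hW : ∀ b, Commute ((W b : Matrix.specialUnitaryGroup (Fin 2) ℂ) : Matrix (Fin 2) (Fin 2) ℂ) σ₃)
    (hStab : ∀ s : GaugeTransf (F.P n) 0 (Matrix.specialUnitaryGroup (Fin 2) ℂ), GaugeField.gaugeAct s V = V →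
      ∃ c : Matrix.specialUnitaryGroup (Fin 2) ℂ, Commute ((c : Matrix.specialUnitaryGroup (Fin 2) ℂ) : Matrix (Fin 2) (Fin 2) ℂ) σ₃ ∧ s = fun _ => c) :
    ∀ s : GaugeTransf (F.P n) 0 (Matrix.specialUnitaryGroup (Fin 2) ℂ), GaugeField.gaugeAct s V = V →
      ∃ k : GaugeTransf (F.P K) 0 (Matrix.specialUnitaryGroup (Fin 2) ℂ), GaugeField.gaugeAct k W = W ∧ descTransf F n K h k = s := by
  intro s hs
  obtain ⟨c, hc, rfl⟩ := hStab s hs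
  refine ⟨fun _ => c, ?_, descTransf_const F h c⟩
  funext b
  apply Subtype.ext
  show ((c : Matrix.specialUnitaryGroup (Fin 2) ℂ) : Matrix (Fin 2) (Fin 2) ℂ) * ((W b : Matrix.specialUnitaryGroup (Fin 2) ℂ) : Matrix (Fin 2) (Fin 2) ℂ) *
      star ((c : Matrix.specialUnitaryGroup (Fin 2) ℂ) : Matrix (Fin 2) (Fin 2) ℂ) = ((W b : Matrix.specialUnitaryGroup (Fin 2) ℂ) : Matrix (Fin 2) (Fin 2) ℂ)
  rw [(commute_of_commute_sigma3 hc (hW b)).eq, mul_assoc, c.2.1.2, mul_one]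

/-- **CASE A ⇒ DIAGONAL-CONSTANT STABILISER**: if every `V♭`-parallel matrix section is a constant commuting with `σ₃` (case A of
✓`parallelConstDiag_or_loopHol_central`, the genuinely abelian datum), then every gauge transformation fixing `V` is a constant σ₃-diagonal one (its matrix section is
parallel). [cite: Balaban1985BackgroundPropagators, (3.21) p.394; Balaban1985Averaging, (8) p.19] -/
theorem stab_const_of_parallelConstDiag {V : GaugeField (F.P n) 0 (Matrix.specialUnitaryGroup (Fin 2) ℂ)}
    (hA : ∀ c : Site (F.P n) 0 → Matrix (Fin 2) (Fin 2) ℂ,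
      (∀ e : PBond (F.P n) 0, c e.src = ((unitsField (toUField V) e : (Matrix (Fin 2) (Fin 2) ℂ)ˣ) : Matrix (Fin 2) (Fin 2) ℂ) * c e.tgt *
        (((unitsField (toUField V) e)⁻¹ : (Matrix (Fin 2) (Fin 2) ℂ)ˣ) : Matrix (Fin 2) (Fin 2) ℂ)) →
      ∃ c₀ : Matrix (Fin 2) (Fin 2) ℂ, (∀ y, c y = c₀) ∧ Commute c₀ σ₃) :
    ∀ s : GaugeTransf (F.P n) 0 (Matrix.specialUnitaryGroup (Fin 2) ℂ), GaugeField.gaugeAct s V = V →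
      ∃ c : Matrix.specialUnitaryGroup (Fin 2) ℂ, Commute ((c : Matrix.specialUnitaryGroup (Fin 2) ℂ) : Matrix (Fin 2) (Fin 2) ℂ) σ₃ ∧ s = fun _ => c := by
  intro s hs
  -- the matrix section of `s` is `V♭`-parallel
  have hpar : ∀ e : PBond (F.P n) 0, ((s e.src : Matrix.specialUnitaryGroup (Fin 2) ℂ) : Matrix (Fin 2) (Fin 2) ℂ) =
      ((unitsField (toUField V) e : (Matrix (Fin 2) (Fin 2) ℂ)ˣ) : Matrix (Fin 2) (Fin 2) ℂ) * ((s e.tgt : Matrix.specialUnitaryGroup (Fin 2) ℂ) : Matrix (Fin 2) (Fin 2) ℂ) *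
        (((unitsField (toUField V) e)⁻¹ : (Matrix (Fin 2) (Fin 2) ℂ)ˣ) : Matrix (Fin 2) (Fin 2) ℂ) := by
    intro e
    rw [coe_unitsField_toUField, coe_inv_unitsField_toUField]
    have he : ((s e.src : Matrix.specialUnitaryGroup (Fin 2) ℂ) : Matrix (Fin 2) (Fin 2) ℂ) * ((V e : Matrix.specialUnitaryGroup (Fin 2) ℂ) : Matrix (Fin 2) (Fin 2) ℂ) *
        star ((s e.tgt : Matrix.specialUnitaryGroup (Fin 2) ℂ) : Matrix (Fin 2) (Fin 2) ℂ) = ((V e : Matrix.specialUnitaryGroup (Fin 2) ℂ) : Matrix (Fin 2) (Fin 2) ℂ) :=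
      congrArg (fun U : GaugeField (F.P n) 0 (Matrix.specialUnitaryGroup (Fin 2) ℂ) => ((U e : Matrix.specialUnitaryGroup (Fin 2) ℂ) : Matrix (Fin 2) (Fin 2) ℂ)) hs
    have hS : star ((s e.tgt : Matrix.specialUnitaryGroup (Fin 2) ℂ) : Matrix (Fin 2) (Fin 2) ℂ) * ((s e.tgt : Matrix.specialUnitaryGroup (Fin 2) ℂ) : Matrix (Fin 2) (Fin 2) ℂ) = 1 :=
      (s e.tgt).2.1.1
    have hV : ((V e : Matrix.specialUnitaryGroup (Fin 2) ℂ) : Matrix (Fin 2) (Fin 2) ℂ) * star ((V e : Matrix.specialUnitaryGroup (Fin 2) ℂ) : Matrix (Fin 2) (Fin 2) ℂ) = 1 :=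
      (V e).2.1.2
    calc ((s e.src : Matrix.specialUnitaryGroup (Fin 2) ℂ) : Matrix (Fin 2) (Fin 2) ℂ)
        = ((s e.src : Matrix.specialUnitaryGroup (Fin 2) ℂ) : Matrix (Fin 2) (Fin 2) ℂ) * (((V e : Matrix.specialUnitaryGroup (Fin 2) ℂ) : Matrix (Fin 2) (Fin 2) ℂ) *
            star ((V e : Matrix.specialUnitaryGroup (Fin 2) ℂ) : Matrix (Fin 2) (Fin 2) ℂ)) := by rw [hV, mul_one]
      _ = (((s e.src : Matrix.specialUnitaryGroup (Fin 2) ℂ) : Matrix (Fin 2) (Fin 2) ℂ) * ((V e : Matrix.specialUnitaryGroup (Fin 2) ℂ) : Matrix (Fin 2) (Fin 2) ℂ) *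
            star ((s e.tgt : Matrix.specialUnitaryGroup (Fin 2) ℂ) : Matrix (Fin 2) (Fin 2) ℂ)) *
            (((s e.tgt : Matrix.specialUnitaryGroup (Fin 2) ℂ) : Matrix (Fin 2) (Fin 2) ℂ)) * star ((V e : Matrix.specialUnitaryGroup (Fin 2) ℂ) : Matrix (Fin 2) (Fin 2) ℂ) := by
          rw [mul_assoc _ (star _) ((s e.tgt : Matrix.specialUnitaryGroup (Fin 2) ℂ) : Matrix (Fin 2) (Fin 2) ℂ), hS, mul_one, mul_assoc]
      _ = ((V e : Matrix.specialUnitaryGroup (Fin 2) ℂ) : Matrix (Fin 2) (Fin 2) ℂ) * ((s e.tgt : Matrix.specialUnitaryGroup (Fin 2) ℂ) : Matrix (Fin 2) (Fin 2) ℂ) *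
            star ((V e : Matrix.specialUnitaryGroup (Fin 2) ℂ) : Matrix (Fin 2) (Fin 2) ℂ) := by rw [he]
  obtain ⟨c₀, hc₀, hcσ⟩ := hA (fun y => ((s y : Matrix.specialUnitaryGroup (Fin 2) ℂ) : Matrix (Fin 2) (Fin 2) ℂ)) hpar
  refine ⟨s (ofT (0 : TT (F.P n) 0)), ?_, ?_⟩
  · rw [hc₀]; exact hcσ
  · funext y
    apply Subtype.ext
    rw [hc₀ y, hc₀]

/-- **THE SMALLNESS OF A REGULAR CONFIGURATION'S ITERATED AVERAGES** (Prop. 2 of [Balaban1985Averaging] for (0.4), ✓`plaqSmall_two_iter_blockAvg`) and the Stokes guard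
`stokesConst·(2e) < δ₂`, from the two admissibility rows. [cite: Balaban1985Averaging, (52)-(54) p.26; Balaban1985Variational, (2) p.278] -/
theorem smallness_of_regPr {e : ℝ} (he : 0 < e) (hr3 : (143 * ((((3 + 4 : ℕ) : ℝ)) ^ 2 / 4) ^ 2) * e ≤ 1 / 3)
    (hr2 : 2 * e ≤ 2 * deltaSU (Fin 2) / (((3 + 4) * F.L : ℕ) : ℝ) ^ 2) {W : GaugeField (F.P K) 0 (Matrix.specialUnitaryGroup (Fin 2) ℂ)} (hW : RegPr F n K e W) :
    0 < 2 * e ∧ stokesConst (F.P K) * (2 * e) < deltaSU (Fin 2) ∧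
      ∀ i, i < K - n → PlaqSmall (2 * e) (Averaging.iter (fun i => blockAvg (P := F.P K) (j := i) (expMeanLogSU (n := Fin 2))) i W) := by
  have hd : (F.P K).d = 3 := rfl
  have hLL : (F.P K).L = F.L := rfl
  have hα3 : (143 * ((((( F.P K).d + 4 : ℕ) : ℝ)) ^ 2 / 4) ^ 2) * e ≤ 1 / 3 := by rw [hd]; exact hr3
  have hα2 : 2 * e ≤ 2 * deltaSU (Fin 2) / ((((F.P K).d + 4) * (F.P K).L : ℕ) : ℝ) ^ 2 := by rw [hd, hLL]; exact hr2
  have h52 : PlaqSmall (e * ((((F.P K).L : ℝ) ^ (K - n))⁻¹) ^ 2) W := by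
    have hp := hW.plaqSmall
    have heq : regThreshold F n K e = e * ((((F.P K).L : ℝ) ^ (K - n))⁻¹) ^ 2 := by
      unfold regThreshold; rw [hLL, ← inv_pow, ← pow_mul, mul_comm 2 (K - n)]
    rw [heq] at hp; exact hp
  refine ⟨by positivity, ?_, fun i hi => plaqSmall_two_iter_blockAvg (K - n) he hα3 hα2 h52 hi.le⟩
  unfold stokesConst
  rw [hd, hLL]
  have h7 : ((((3 + 4) * F.L : ℕ) : ℝ)) ^ 2 = 49 * (F.L : ℝ) ^ 2 := by push_cast; ring
  have h5' : ((((3 + 2) * F.L : ℕ) : ℝ)) ^ 2 = 25 * (F.L : ℝ) ^ 2 := by push_cast; ring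
  rw [h7] at hr2
  rw [h5']
  have hL2 : (0 : ℝ) < (F.L : ℝ) ^ 2 := by have := F.hL.2; positivity
  have hδ := deltaSU_pos (n := Fin 2)
  rw [le_div_iff₀ (by positivity)] at hr2
  nlinarith

end Pieces

/-! ## §2 Prop. 7 clause 1 at the abelian datum, modulo EX^{ab} -/

section Assembly

/-- ★★★ **[Balaban1985Variational] PROP. 7 CLAUSE 1 AT THE ABELIAN STRATUM, MODULO EX^{ab}, EVERY `L ≥ 5`.**  There is `e₉ > 0` such that for every member `F` with
`F.L = L`, heights `n < K` with `K − n ≤ m + K_P`, every `0 < e ≤ e₉` with the admissibility rows `143·(49∕4)²·e ≤ 1∕3`, `2e ≤ 2δ₂∕(7L)²`, every datum `V` whose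
stabiliser consists of constant σ₃-diagonal gauge transformations (`hStab`), and every lettering `a` with strict loop-sum guards `3|Σ(linAvgIter s′ a)| < 1` below
`K − n` such that `W := e^{a·iσ₃} ∈ regFibrePr F n K e V` minimises the Wilson action among the σ₃-DIAGONAL members of `regFibrePr F n K e V` (EX^{ab}): ANY TWO
R2-CRITICAL points of (6)(e) over `V` lie on one orbit of print's group (4) — `(varProblem3 F n K hnK.le).AtMostOneCriticalOrbit e V`.  Proof: ✓pen 7
`atMostOneCriticalOrbit_of_el_symmetriesLift_five` with `W := e^{a·iσ₃}`, its E–L letter by ✓FILE 2 `el_of_abelianMin` (smallness rows by §1 `smallness_of_regPr`), its lift letter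
by §1 `symmetriesLift_of_diagonal`.
[cite: Balaban1985Variational, Prop. 7 p.299, (2)-(6) p.278, (141)-(143) p.299; Balaban1985RegularSpaces, Thm 2 p.83; Balaban1985Averaging, (52)-(54) p.26] -/
theorem atMostOneCriticalOrbit_of_abelianMin_five (L : ℕ) (h5 : 5 ≤ L) :
    ∃ e₉ : ℝ, 0 < e₉ ∧ ∀ (F : T3Family), F.L = L → ∀ (n K : ℕ) (hnK : n < K), K - n ≤ (F.P K).m + (F.P K).K →
      ∀ (e : ℝ) (V : GaugeField (F.P n) 0 (Matrix.specialUnitaryGroup (Fin 2) ℂ)) (a : PBond (F.P K) 0 → ℝ),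
      0 < e → e ≤ e₉ → (143 * ((((3 + 4 : ℕ) : ℝ)) ^ 2 / 4) ^ 2) * e ≤ 1 / 3 → 2 * e ≤ 2 * deltaSU (Fin 2) / (((3 + 4) * F.L : ℕ) : ℝ) ^ 2 →
      (∀ s : GaugeTransf (F.P n) 0 (Matrix.specialUnitaryGroup (Fin 2) ℂ), GaugeField.gaugeAct s V = V →
        ∃ c : Matrix.specialUnitaryGroup (Fin 2) ℂ, Commute ((c : Matrix.specialUnitaryGroup (Fin 2) ℂ) : Matrix (Fin 2) (Fin 2) ℂ) σ₃ ∧ s = fun _ => c) →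
      (∀ s', s' < K - n → ∀ (c : PBond (F.P K) (s' + 1)) (i : Idx (F.P K)), 3 * |loopSum (linAvgIter s' a) c i| < 1) →
      gexpAt (suGroupModel 2) I_smul_sigma3_mem_lie a ∈ regFibrePr F n K hnK.le e V →
      (∀ W' : GaugeField (F.P K) 0 (Matrix.specialUnitaryGroup (Fin 2) ℂ),
        (∀ b, Commute ((W' b : Matrix.specialUnitaryGroup (Fin 2) ℂ) : Matrix (Fin 2) (Fin 2) ℂ) σ₃) → W' ∈ regFibrePr F n K hnK.le e V →
          wilsonAction4 (gexpAt (suGroupModel 2) I_smul_sigma3_mem_lie a) ≤ wilsonAction4 W') →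
      (varProblem3 F n K hnK.le).AtMostOneCriticalOrbit e V := by
  obtain ⟨e₈, he₈, H⟩ := atMostOneCriticalOrbit_of_el_symmetriesLift_five L h5
  refine ⟨e₈, he₈, ?_⟩
  intro F hF n K hnK hk e V a he hee hr3 hr2 hStab hloop hreg hmin
  obtain ⟨ht₀, hstδ, hsm⟩ := smallness_of_regPr F he hr3 hr2 ((mem_regFibrePr_iff F).mp hreg).2
  exact H F hF n K hnK e V he hee ⟨_, hreg, el_of_abelianMin F hnK.le hk ht₀ hstδ a hloop hsm hreg hmin,
    symmetriesLift_of_diagonal F hnK.le (fun b => commute_coe_gexpAt_sigma3 a b) hStab⟩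

/-- ★★★ **THE LIFT PROPERTY AT EVERY R2-CRITICAL POINT OVER AN ABELIAN DATUM, MODULO EX^{ab}** — the `hlift` token of pen 4 ∕ (T7-red) at the organ's base point `U₀`:
under the hypotheses of `atMostOneCriticalOrbit_of_abelianMin_five`, every R2-critical `U₀ ∈ regFibrePr F n K e V` is `u • W` with `(u↓) • V = V` (✓pen 7
`critical_gaugeRelated_of_el_five`: both points are E–L-critical), and the lift property of the diagonal `W` transports along `u` (✓pen 7 `symmetriesLift_gaugeAct`).
[cite: Balaban1985Variational, (4)-(6) p.278, Prop. 7 p.299, (141)-(143) p.299; Balaban1985Averaging, (11)-(13) p.19] -/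
theorem symmetriesLift_at_critical_of_abelianMin_five (L : ℕ) (h5 : 5 ≤ L) :
    ∃ e₉ : ℝ, 0 < e₉ ∧ ∀ (F : T3Family), F.L = L → ∀ (n K : ℕ) (hnK : n < K), K - n ≤ (F.P K).m + (F.P K).K →
      ∀ (e : ℝ) (V : GaugeField (F.P n) 0 (Matrix.specialUnitaryGroup (Fin 2) ℂ)) (a : PBond (F.P K) 0 → ℝ),
      0 < e → e ≤ e₉ → (143 * ((((3 + 4 : ℕ) : ℝ)) ^ 2 / 4) ^ 2) * e ≤ 1 / 3 → 2 * e ≤ 2 * deltaSU (Fin 2) / (((3 + 4) * F.L : ℕ) : ℝ) ^ 2 →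
      (∀ s : GaugeTransf (F.P n) 0 (Matrix.specialUnitaryGroup (Fin 2) ℂ), GaugeField.gaugeAct s V = V →
        ∃ c : Matrix.specialUnitaryGroup (Fin 2) ℂ, Commute ((c : Matrix.specialUnitaryGroup (Fin 2) ℂ) : Matrix (Fin 2) (Fin 2) ℂ) σ₃ ∧ s = fun _ => c) →
      (∀ s', s' < K - n → ∀ (c : PBond (F.P K) (s' + 1)) (i : Idx (F.P K)), 3 * |loopSum (linAvgIter s' a) c i| < 1) →
      gexpAt (suGroupModel 2) I_smul_sigma3_mem_lie a ∈ regFibrePr F n K hnK.le e V →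
      (∀ W' : GaugeField (F.P K) 0 (Matrix.specialUnitaryGroup (Fin 2) ℂ),
        (∀ b, Commute ((W' b : Matrix.specialUnitaryGroup (Fin 2) ℂ) : Matrix (Fin 2) (Fin 2) ℂ) σ₃) → W' ∈ regFibrePr F n K hnK.le e V →
          wilsonAction4 (gexpAt (suGroupModel 2) I_smul_sigma3_mem_lie a) ≤ wilsonAction4 W') →
      ∀ U₀ : GaugeField (F.P K) 0 (Matrix.specialUnitaryGroup (Fin 2) ℂ), U₀ ∈ regFibrePr F n K hnK.le e V → IsCritR2 F n K hnK.le V U₀ →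
        ∀ s : GaugeTransf (F.P n) 0 (Matrix.specialUnitaryGroup (Fin 2) ℂ), GaugeField.gaugeAct s V = V →
          ∃ k : GaugeTransf (F.P K) 0 (Matrix.specialUnitaryGroup (Fin 2) ℂ), GaugeField.gaugeAct k U₀ = U₀ ∧ descTransf F n K hnK.le k = s := by
  obtain ⟨e₈, he₈, H⟩ := critical_gaugeRelated_of_el_five L h5
  refine ⟨e₈, he₈, ?_⟩
  intro F hF n K hnK hk e V a he hee hr3 hr2 hStab hloop hreg hmin U₀ hU₀ hcrit
  obtain ⟨ht₀, hstδ, hsm⟩ := smallness_of_regPr F he hr3 hr2 ((mem_regFibrePr_iff F).mp hreg).2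
  have hELW := el_of_abelianMin F hnK.le hk ht₀ hstδ a hloop hsm hreg hmin
  have hELU : ∀ γ : ℝ → GaugeField (F.P K) 0 (Matrix.specialUnitaryGroup (Fin 2) ℂ), γ 0 = U₀ → (∀ t, γ t ∈ fibre F ℰp n K hnK.le V) →
      (∀ b, DifferentiableAt ℝ (fun t => ((γ t b : Matrix.specialUnitaryGroup (Fin 2) ℂ) : Matrix (Fin 2) (Fin 2) ℂ)) 0) →
        deriv (fun t => wilsonAction4 (γ t)) 0 = 0 :=
    fun γ hγ0 hγfib hγd => deriv_comp_eq_zero_of_isCritR2 hcrit γ hγ0 hγfib (continuousAt_of_differentiableAt_bonds γ hγd)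
  obtain ⟨u, rfl, hfix⟩ := H F hF n K hnK e V _ U₀ he hee hreg hELW hU₀ hELU
  exact symmetriesLift_gaugeAct F hnK.le u hfix (symmetriesLift_of_diagonal F hnK.le (fun b => commute_coe_gexpAt_sigma3 a b) hStab)

/-- ★★★ **THE SAME AT A CASE-A DIAGONAL DATUM** (✓`parallelConstDiag_or_loopHol_central`'s first disjunct in place of `hStab`): Prop. 7 clause 1 over every coarse `V` all of
whose `V♭`-parallel matrix sections are constants commuting with `σ₃`, modulo EX^{ab}. [cite: Balaban1985Variational, Prop. 7 p.299; Balaban1985BackgroundPropagators, (3.21) p.394] -/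
theorem atMostOneCriticalOrbit_of_abelianMin_caseA_five (L : ℕ) (h5 : 5 ≤ L) :
    ∃ e₉ : ℝ, 0 < e₉ ∧ ∀ (F : T3Family), F.L = L → ∀ (n K : ℕ) (hnK : n < K), K - n ≤ (F.P K).m + (F.P K).K →
      ∀ (e : ℝ) (V : GaugeField (F.P n) 0 (Matrix.specialUnitaryGroup (Fin 2) ℂ)) (a : PBond (F.P K) 0 → ℝ),
      0 < e → e ≤ e₉ → (143 * ((((3 + 4 : ℕ) : ℝ)) ^ 2 / 4) ^ 2) * e ≤ 1 / 3 → 2 * e ≤ 2 * deltaSU (Fin 2) / (((3 + 4) * F.L : ℕ) : ℝ) ^ 2 →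
      (∀ c : Site (F.P n) 0 → Matrix (Fin 2) (Fin 2) ℂ,
        (∀ e' : PBond (F.P n) 0, c e'.src = ((unitsField (toUField V) e' : (Matrix (Fin 2) (Fin 2) ℂ)ˣ) : Matrix (Fin 2) (Fin 2) ℂ) * c e'.tgt *
          (((unitsField (toUField V) e')⁻¹ : (Matrix (Fin 2) (Fin 2) ℂ)ˣ) : Matrix (Fin 2) (Fin 2) ℂ)) →
        ∃ c₀ : Matrix (Fin 2) (Fin 2) ℂ, (∀ y, c y = c₀) ∧ Commute c₀ σ₃) →
      (∀ s', s' < K - n → ∀ (c : PBond (F.P K) (s' + 1)) (i : Idx (F.P K)), 3 * |loopSum (linAvgIter s' a) c i| < 1) →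
      gexpAt (suGroupModel 2) I_smul_sigma3_mem_lie a ∈ regFibrePr F n K hnK.le e V →
      (∀ W' : GaugeField (F.P K) 0 (Matrix.specialUnitaryGroup (Fin 2) ℂ),
        (∀ b, Commute ((W' b : Matrix.specialUnitaryGroup (Fin 2) ℂ) : Matrix (Fin 2) (Fin 2) ℂ) σ₃) → W' ∈ regFibrePr F n K hnK.le e V →
          wilsonAction4 (gexpAt (suGroupModel 2) I_smul_sigma3_mem_lie a) ≤ wilsonAction4 W') →
      (varProblem3 F n K hnK.le).AtMostOneCriticalOrbit e V := by
  obtain ⟨e₉, he₉, H⟩ := atMostOneCriticalOrbit_of_abelianMin_five L h5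
  exact ⟨e₉, he₉, fun F hF n K hnK hk e V a he hee hr3 hr2 hA => H F hF n K hnK hk e V a he hee hr3 hr2 (stab_const_of_parallelConstDiag F hA)⟩

end Assembly

end Summit.QuantumFields.YangMills.Theorems.FluctuationComparisonRegPrIntLS2BetaCriticalOrbitUniqueAbelian

end
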